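import Summits.NavierStokesRegularity.NavierStokesRegularity.Theorems.AdaptedFrequencyAdaptedKernelExistsKernelLimitSlices
import Mathlib.MeasureTheory.Integral.DominatedConvergence
import Mathlib.MeasureTheory.Function.LocallyIntegrable

/-!
# Crux `AdaptedKernelExists` (stmt-NavierStokesRegularity-2956), line `nash-entropy-last-block`:
  STUB `stub_kernelLimit`, part 6 — the pointwise limit is a very weak solution

Helper file (lands `--supports stmt-NavierStokesRegularity-2956`) on the proof path of the
registered stub `stub_kernelLimit`.  Abstract limit step: let `Gₙ` be functions continuous on
the open slab `O = Ioo tₘ T ×ˢ univ`, locally uniformly bounded on sub-slabs `{t ≤ t₂}`,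
`t₂ < T`, converging pointwise on `O` to `G`, and let each `Gₙ` be a very weak solution (the
currency of the gen-4 skeleton) of the backward drift–heat equation with a drift `bₙ` that
coincides with the fixed drift `b` on `[tₘ, Tₙ]`, `Tₙ → T`.  Then

* `kernelLimit_exists_time_window` — the time-shadow of a test function compactly supported in
  the open slab lies in a compact window `(a₁, b₁)`, `tₘ < a₁ < b₁ < T`;
* `kernelLimit_testIntegrand_continuous` — the very weak integrand
  `Ψ_b φ = ∂ₜφ + Dₓφ[b] − νΔₓφ` is continuous with support in `tsupport φ` when `b` is
  continuous on the slab;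
* `kernelLimit_locallyIntegrableOn_limit` — `G` is locally integrable on `O`;
* `kernelLimit_veryWeak_limit` — `G` is a very weak solution for the drift `b`
  (dominated convergence: on the support of `φ` the drifts `bₙ` eventually equal `b`);
* `kernelLimit_le_of_ae_le`, `kernelLimit_ae_ae` — transfer of a.e. statements (an open null set
  is empty; Fubini for null sets).
-/

noncomputable section

open MeasureTheory Set Filter Topology Metric Function
open scoped Laplacian ContDiff
open Literature.Analysis.FluidPDE

namespace Summit.NavierStokesRegularity.NavierStokesRegularity.Theorems.AdaptedKernelExists.NashEntropyLastBlock

section General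

variable {E : Type*} [NormedAddCommGroup E] [InnerProductSpace ℝ E] [FiniteDimensional ℝ E]
  [MeasurableSpace E] [BorelSpace E]

omit [InnerProductSpace ℝ E] [FiniteDimensional ℝ E] [MeasurableSpace E] [BorelSpace E] in
/-- **Time window of a test function.**  If `φ` has compact support inside the open slab
`Ioo tₘ T ×ˢ univ` and is not identically zero, its time-shadow lies in a compact window:
there are `tₘ < a₁ < b₁ < T` with `p.1 ∈ Ioo a₁ b₁` for every `p ∈ tsupport φ`. -/
theorem kernelLimit_exists_time_window {tₘ T : ℝ} {φ : ℝ × E → ℝ} (hφc : HasCompactSupport φ)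
    (hφs : tsupport φ ⊆ Ioo tₘ T ×ˢ univ) (hne : (tsupport φ).Nonempty) :
    ∃ a₁ b₁ : ℝ, tₘ < a₁ ∧ b₁ < T ∧ a₁ < b₁ ∧ ∀ p ∈ tsupport φ, p.1 ∈ Ioo a₁ b₁ := by
  set K : Set ℝ := Prod.fst '' tsupport φ with hK
  have hKc : IsCompact K := hφc.isCompact.image continuous_fst
  have hKne : K.Nonempty := hne.image _
  have hKI : K ⊆ Ioo tₘ T := by
    rintro _ ⟨p, hp, rfl⟩; exact (hφs hp).1
  have hlo := hKc.sInf_mem hKne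
  have hhi := hKc.sSup_mem hKne
  refine ⟨(tₘ + sInf K) / 2, (sSup K + T) / 2, by linarith [(hKI hlo).1],
    by linarith [(hKI hhi).2], ?_, fun p hp => ?_⟩
  · have : sInf K ≤ sSup K := le_csSup hKc.bddAbove hlo
    linarith [(hKI hlo).1, (hKI hhi).2]
  · have hpK : p.1 ∈ K := ⟨p, hp, rfl⟩
    have h1 : sInf K ≤ p.1 := csInf_le hKc.bddBelow hpK
    have h2 : p.1 ≤ sSup K := le_csSup hKc.bddAbove hpK
    exact ⟨by linarith [(hKI hlo).1], by linarith [(hKI hhi).2]⟩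

omit [MeasurableSpace E] [BorelSpace E] in
/-- **The very weak integrand of a test function is continuous with support in the support of
the test function** when the drift is continuous on the open slab containing that support. -/
theorem kernelLimit_testIntegrand_continuous {ν tₘ T : ℝ} {b : ℝ → E → E}
    (hbc : ContinuousOn (fun p : ℝ × E => b p.1 p.2) (Ioo tₘ T ×ˢ univ)) {φ : ℝ × E → ℝ}
    (hφ : ContDiff ℝ ∞ φ) (hφs : tsupport φ ⊆ Ioo tₘ T ×ˢ univ) :
    Continuous (fun p : ℝ × E => deriv (fun s => φ (s, p.2)) p.1 +
        fderiv ℝ (fun y => φ (p.1, y)) p.2 (b p.1 p.2) - ν * (Δ (fun y => φ (p.1, y))) p.2) ∧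
      ∀ p ∉ tsupport φ, deriv (fun s => φ (s, p.2)) p.1 +
        fderiv ℝ (fun y => φ (p.1, y)) p.2 (b p.1 p.2) - ν * (Δ (fun y => φ (p.1, y))) p.2 = 0 := by
  have hO : IsOpen (Ioo tₘ T ×ˢ (univ : Set E)) := isOpen_Ioo.prod isOpen_univ
  have hzero : ∀ p ∉ tsupport φ, deriv (fun s => φ (s, p.2)) p.1 +
      fderiv ℝ (fun y => φ (p.1, y)) p.2 (b p.1 p.2) - ν * (Δ (fun y => φ (p.1, y))) p.2 = 0 := by
    intro p hp
    obtain ⟨h1, h2, h3⟩ := kernelLimit_sliceDerivs_eq_zero hp (b p.1 p.2)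
    rw [h1, h2, h3]; ring
  refine ⟨?_, hzero⟩
  have hφb_c : Continuous fun p : ℝ × E => fderiv ℝ (fun y => φ (p.1, y)) p.2 (b p.1 p.2) := by
    refine kernelLimit_continuous_of_tsupport_subset hO ?_ ?_
    · exact (kernelLimit_continuous_fderiv_slice hφ).continuousOn.clm_apply hbc
    · refine (closure_minimal (fun p hp => ?_) (isClosed_tsupport φ)).trans hφs
      by_contra h
      exact hp (kernelLimit_sliceDerivs_eq_zero h (b p.1 p.2)).2.1
  exact ((kernelLimit_continuous_deriv_slice hφ).add hφb_c).sub
    (continuous_const.mul (kernelLimit_continuous_laplacian_slice hφ))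

/-- **Local integrability of a pointwise limit.**  If `Gₙ` are continuous on the open slab
`O = Ioo tₘ T ×ˢ univ`, uniformly bounded on every sub-slab `{tₘ < t ≤ t₂}`, `t₂ < T`, and
converge pointwise on `O` to `G`, then `G` is locally integrable on `O`. -/
theorem kernelLimit_locallyIntegrableOn_limit {tₘ T : ℝ} {Gs : ℕ → ℝ → E → ℝ} {G : ℝ → E → ℝ}
    (hcont : ∀ n, ContinuousOn (fun p : ℝ × E => Gs n p.1 p.2) (Ioo tₘ T ×ˢ univ))
    (hbound : ∀ t₂ : ℝ, t₂ < T → ∃ Mb : ℝ, ∀ n, ∀ t ∈ Ioc tₘ t₂, ∀ x, |Gs n t x| ≤ Mb)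
    (hconv : ∀ t ∈ Ioo tₘ T, ∀ x, Tendsto (fun n => Gs n t x) atTop (𝓝 (G t x))) :
    LocallyIntegrableOn (fun p : ℝ × E => G p.1 p.2) (Ioo tₘ T ×ˢ univ) volume := by
  intro p hp
  obtain ⟨ht, -⟩ := hp
  -- a compact neighbourhood within the slab
  obtain ⟨ε, hε, hεI⟩ : ∃ ε : ℝ, 0 < ε ∧ Icc (p.1 - ε) (p.1 + ε) ⊆ Ioo tₘ T := by
    have hm : 0 < min (p.1 - tₘ) (T - p.1) := lt_min (sub_pos.2 ht.1) (sub_pos.2 ht.2)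
    refine ⟨min (p.1 - tₘ) (T - p.1) / 2, by positivity, fun s hs => ⟨?_, ?_⟩⟩
    · have h1 : min (p.1 - tₘ) (T - p.1) ≤ p.1 - tₘ := min_le_left _ _
      linarith [hs.1]
    · have h1 : min (p.1 - tₘ) (T - p.1) ≤ T - p.1 := min_le_right _ _
      linarith [hs.2]
  set U : Set (ℝ × E) := Icc (p.1 - ε) (p.1 + ε) ×ˢ closedBall p.2 1 with hU
  have hUc : IsCompact U := isCompact_Icc.prod (isCompact_closedBall _ _)
  have hUO : U ⊆ Ioo tₘ T ×ˢ univ := prod_mono hεI (subset_univ _)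
  have hUn : U ∈ 𝓝[Ioo tₘ T ×ˢ univ] p := by
    refine mem_nhdsWithin_of_mem_nhds ?_
    rw [hU]
    exact prod_mem_nhds (Icc_mem_nhds (by linarith) (by linarith)) (closedBall_mem_nhds _ one_pos)
  refine ⟨U, hUn, ?_⟩
  -- uniform bound on `U`
  have ht₂ : p.1 + ε < T := (hεI ⟨by linarith, le_rfl⟩).2
  obtain ⟨Mb, hMb⟩ := hbound (p.1 + ε) ht₂
  have hbd : ∀ q ∈ U, |G q.1 q.2| ≤ Mb := by
    intro q hq
    have hq1 : q.1 ∈ Ioc tₘ (p.1 + ε) := ⟨(hεI hq.1).1, hq.1.2⟩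
    have hqO : q.1 ∈ Ioo tₘ T := hεI hq.1
    refine le_of_tendsto ((continuous_abs.tendsto _).comp (hconv q.1 hqO q.2)) ?_
    exact Eventually.of_forall fun n => hMb n q.1 hq1 q.2
  -- a.e.-measurability on `U` as an a.e. limit of continuous functions
  have hmeas : AEStronglyMeasurable (fun q : ℝ × E => G q.1 q.2) (volume.restrict U) := by
    refine aestronglyMeasurable_of_tendsto_ae atTop
      (f := fun n => fun q : ℝ × E => Gs n q.1 q.2) (fun n => ?_) ?_
    · exact ((hcont n).mono hUO).aestronglyMeasurable hUc.measurableSet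
    · rw [ae_restrict_iff' hUc.measurableSet]
      exact Eventually.of_forall fun q hq => hconv q.1 (hεI hq.1) q.2
  have hvol : volume U < ⊤ := hUc.measure_lt_top
  refine ⟨hmeas, HasFiniteIntegral.restrict_of_bounded Mb hvol ?_⟩
  rw [ae_restrict_iff' hUc.measurableSet]
  exact Eventually.of_forall fun q hq => by rw [Real.norm_eq_abs]; exact hbd q hq

/-- **The pointwise limit is a very weak solution.**  Let `b` be jointly smooth on `Ico tₘ T`,
`Gₙ` continuous on the open slab, uniformly bounded on sub-slabs `{tₘ < t ≤ t₂}` (`t₂ < T`),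
converging pointwise on the slab to `G`; let each `Gₙ` be a very weak solution of the backward
drift–heat equation with viscosity `ν` and a drift `bₙ` equal to `b` on `[tₘ, Tₙ]`, where
`Tₙ` eventually exceeds every `t < T`.  Then `G` is a very weak solution for the drift `b`. -/
theorem kernelLimit_veryWeak_limit {ν tₘ T : ℝ} {b : ℝ → E → E} {bs : ℕ → ℝ → E → E}
    {Gs : ℕ → ℝ → E → ℝ} {G : ℝ → E → ℝ} {Tn : ℕ → ℝ}
    (hb : IsSmoothSpaceTimeOn (Ico tₘ T) b)
    (hTn : ∀ t : ℝ, t < T → ∃ N : ℕ, ∀ n, N ≤ n → t ≤ Tn n)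
    (hagree : ∀ n, ∀ t ∈ Icc tₘ (Tn n), bs n t = b t)
    (hcont : ∀ n, ContinuousOn (fun p : ℝ × E => Gs n p.1 p.2) (Ioo tₘ T ×ˢ univ))
    (hbound : ∀ t₂ : ℝ, t₂ < T → ∃ Mb : ℝ, ∀ n, ∀ t ∈ Ioc tₘ t₂, ∀ x, |Gs n t x| ≤ Mb)
    (hconv : ∀ t ∈ Ioo tₘ T, ∀ x, Tendsto (fun n => Gs n t x) atTop (𝓝 (G t x)))
    (hweak : ∀ n, ∀ φ : ℝ × E → ℝ, ContDiff ℝ ∞ φ → HasCompactSupport φ →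
      tsupport φ ⊆ Ioo tₘ T ×ˢ univ →
      ∫ p : ℝ × E, Gs n p.1 p.2 * (deriv (fun s => φ (s, p.2)) p.1 +
        fderiv ℝ (fun y => φ (p.1, y)) p.2 (bs n p.1 p.2) - ν * (Δ (fun y => φ (p.1, y))) p.2) = 0)
    (φ : ℝ × E → ℝ) (hφ : ContDiff ℝ ∞ φ) (hφc : HasCompactSupport φ)
    (hφs : tsupport φ ⊆ Ioo tₘ T ×ˢ univ) :
    ∫ p : ℝ × E, G p.1 p.2 * (deriv (fun s => φ (s, p.2)) p.1 +
      fderiv ℝ (fun y => φ (p.1, y)) p.2 (b p.1 p.2) - ν * (Δ (fun y => φ (p.1, y))) p.2) = 0 := by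
  have hO : IsOpen (Ioo tₘ T ×ˢ (univ : Set E)) := isOpen_Ioo.prod isOpen_univ
  have hbc : ContinuousOn (fun p : ℝ × E => b p.1 p.2) (Ioo tₘ T ×ˢ univ) :=
    hb.continuousOn.mono (prod_mono Ioo_subset_Ico_self Subset.rfl)
  set Ψ : ℝ × E → ℝ := fun p => deriv (fun s => φ (s, p.2)) p.1 +
    fderiv ℝ (fun y => φ (p.1, y)) p.2 (b p.1 p.2) - ν * (Δ (fun y => φ (p.1, y))) p.2 with hΨ
  obtain ⟨hΨc, hΨ0⟩ : Continuous Ψ ∧ ∀ p ∉ tsupport φ, Ψ p = 0 :=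
    kernelLimit_testIntegrand_continuous (ν := ν) hbc hφ hφs
  change ∫ p, G p.1 p.2 * Ψ p = 0
  -- the trivial case `φ = 0`
  by_cases hne : ¬ (tsupport φ).Nonempty
  · have h0 : ∀ p, p ∉ tsupport φ := fun p hp => hne ⟨p, hp⟩
    have : (fun p : ℝ × E => G p.1 p.2 * Ψ p) = fun _ => 0 := by
      funext p; rw [hΨ0 p (h0 p), mul_zero]
    rw [this, integral_zero]
  push Not at hne
  obtain ⟨a₁, b₁, ha₁, hb₁, hab, hwin⟩ := kernelLimit_exists_time_window hφc hφs hne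
  -- eventually the drifts agree on the support, so the pairing with `Gₙ` vanishes
  obtain ⟨N, hN⟩ := hTn b₁ hb₁
  have hvan : ∀ n, N ≤ n → ∫ p, Gs n p.1 p.2 * Ψ p = 0 := by
    intro n hn
    have hagree' : ∀ p, Gs n p.1 p.2 * Ψ p = Gs n p.1 p.2 * (deriv (fun s => φ (s, p.2)) p.1 +
        fderiv ℝ (fun y => φ (p.1, y)) p.2 (bs n p.1 p.2) - ν * (Δ (fun y => φ (p.1, y))) p.2) := by
      intro p
      by_cases hp : p ∈ tsupport φ
      · have h1 : p.1 ∈ Icc tₘ (Tn n) :=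
          ⟨(ha₁.trans (hwin p hp).1).le, ((hwin p hp).2.le.trans (hN n hn))⟩
        simp only [hΨ]
        rw [hagree n p.1 h1]
      · obtain ⟨h1, h2, h3⟩ := kernelLimit_sliceDerivs_eq_zero hp (bs n p.1 p.2)
        rw [hΨ0 p hp, h1, h2, h3]; ring
    have h := hweak n φ hφ hφc hφs
    rw [← h]
    exact integral_congr_ae (Eventually.of_forall hagree')
  -- dominated convergence
  obtain ⟨Mb, hMb⟩ := hbound b₁ hb₁
  have hsuppΨ : ∀ p, Ψ p ≠ 0 → p ∈ tsupport φ := fun p hp => by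
    by_contra h; exact hp (hΨ0 p h)
  have hΨcs : HasCompactSupport Ψ := hφc.of_isClosed_subset (isClosed_tsupport _)
    (closure_minimal (fun p hp => hsuppΨ p hp) (isClosed_tsupport φ))
  have hΨi : Integrable Ψ := hΨc.integrable_of_hasCompactSupport hΨcs
  have hFc : ∀ n, Continuous fun p : ℝ × E => Gs n p.1 p.2 * Ψ p := by
    intro n
    refine kernelLimit_continuous_of_tsupport_subset hO ((hcont n).mul hΨc.continuousOn) ?_
    refine (closure_minimal (fun p hp => ?_) (isClosed_tsupport φ)).trans hφs
    by_contra h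
    exact hp (show Gs n p.1 p.2 * Ψ p = 0 by rw [hΨ0 p h, mul_zero])
  have hlim : Tendsto (fun n => ∫ p, Gs n p.1 p.2 * Ψ p) atTop (𝓝 (∫ p, G p.1 p.2 * Ψ p)) := by
    refine tendsto_integral_of_dominated_convergence (fun p => Mb * |Ψ p|)
      (fun n => (hFc n).aestronglyMeasurable) (hΨi.abs.const_mul Mb) (fun n => ?_) ?_
    · refine Eventually.of_forall fun p => ?_
      by_cases hp : p ∈ tsupport φ
      · have h1 : p.1 ∈ Ioc tₘ b₁ := ⟨ha₁.trans (hwin p hp).1, (hwin p hp).2.le⟩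
        rw [norm_mul, Real.norm_eq_abs, Real.norm_eq_abs]
        exact mul_le_mul_of_nonneg_right (hMb n p.1 h1 p.2) (abs_nonneg _)
      · rw [hΨ0 p hp]; simp
    · refine Eventually.of_forall fun p => ?_
      by_cases hp : p ∈ tsupport φ
      · exact (hconv p.1 (hφs hp).1 p.2).mul_const _
      · rw [hΨ0 p hp]; simp
  have hlim0 : Tendsto (fun n => ∫ p, Gs n p.1 p.2 * Ψ p) atTop (𝓝 0) :=
    tendsto_const_nhds.congr' (by
      rw [EventuallyEq, eventually_atTop]
      exact ⟨N, fun n hn => (hvan n hn).symm⟩)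
  exact tendsto_nhds_unique hlim hlim0

/-! ### Two measure-theoretic transfer lemmas (used by the final assembly) -/

/-- **A pointwise inequality holding a.e. between functions continuous on an open set holds
everywhere on it** (the exceptional set is open and null, hence empty). -/
theorem kernelLimit_le_of_ae_le {O : Set (ℝ × E)} (hO : IsOpen O) {f h : ℝ × E → ℝ}
    (hf : ContinuousOn f O) (hh : ContinuousOn h O) (hae : ∀ᵐ p ∂volume, p ∈ O → f p ≤ h p) :
    ∀ p ∈ O, f p ≤ h p := by
  set V : Set (ℝ × E) := O ∩ (fun p => (h p, f p)) ⁻¹' {q : ℝ × ℝ | q.1 < q.2} with hV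
  have hVo : IsOpen V :=
    (hh.prodMk hf).isOpen_inter_preimage hO (isOpen_lt continuous_fst continuous_snd)
  have hVnull : volume V = 0 := by
    have h0 : volume {p | ¬ (p ∈ O → f p ≤ h p)} = 0 := ae_iff.1 hae
    refine measure_mono_null (fun p hp => ?_) h0
    have hp2 : h p < f p := hp.2
    simp only [mem_setOf_eq, Classical.not_imp, not_le]
    exact ⟨hp.1, hp2⟩
  haveI : (volume : Measure (ℝ × E)).IsOpenPosMeasure := by
    rw [show (volume : Measure (ℝ × E)) = (volume : Measure ℝ).prod (volume : Measure E) from rfl]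
    infer_instance
  have hVe : V = ∅ := (hVo.measure_zero_iff_eq_empty).1 hVnull
  intro p hp
  by_contra hlt
  have : p ∈ V := ⟨hp, by simpa using not_le.1 hlt⟩
  rw [hVe] at this
  exact this

/-- From an a.e. statement on `ℝ × E` to an a.e.-in-`x` statement for a.e. `t` (Fubini for null
sets, `Measure.ae_ae_of_ae_prod`). -/
theorem kernelLimit_ae_ae {P : ℝ × E → Prop} (h : ∀ᵐ p ∂(volume : Measure (ℝ × E)), P p) :
    ∀ᵐ t ∂(volume : Measure ℝ), ∀ᵐ x ∂(volume : Measure E), P (t, x) :=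
  Measure.ae_ae_of_ae_prod (μ := volume) (ν := volume) h

end General

/-! ### Registered sub-goal (dimension three) -/

/-- **Registered sub-goal `stub_kernelLimit_locIntLimit`** (the `ℝ³` form of
`kernelLimit_locallyIntegrableOn_limit`; part 6 of the proof of STUB `stub_kernelLimit`): a
pointwise limit of continuous functions uniformly bounded on sub-slabs is locally integrable on
the open slab. -/
theorem stub_kernelLimit_locIntLimit :
    ∀ (tₘ T : ℝ) (Gs : ℕ → ℝ → EuclideanSpace ℝ (Fin 3) → ℝ) (G : ℝ → EuclideanSpace ℝ (Fin 3) → ℝ), (∀ n, ContinuousOn (fun p : ℝ × EuclideanSpace ℝ (Fin 3) => Gs n p.1 p.2) (Ioo tₘ T ×ˢ univ)) → (∀ t₂ : ℝ, t₂ < T → ∃ Mb : ℝ, ∀ n, ∀ t ∈ Ioc tₘ t₂, ∀ x, |Gs n t x| ≤ Mb) → (∀ t ∈ Ioo tₘ T, ∀ x, Tendsto (fun n => Gs n t x) atTop (𝓝 (G t x))) → LocallyIntegrableOn (fun p : ℝ × EuclideanSpace ℝ (Fin 3) => G p.1 p.2) (Ioo tₘ T ×ˢ univ) volume :=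
  fun _ _ _ _ hcont hbound hconv => kernelLimit_locallyIntegrableOn_limit hcont hbound hconv

end Summit.NavierStokesRegularity.NavierStokesRegularity.Theorems.AdaptedKernelExists.NashEntropyLastBlock

end
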